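import Summits.BirchSwinnertonDyer.BirchSwinnertonDyer.Theorems.RamifiedHeegnerPairLeafPartnerOrdersDualLattice
import Mathlib.RingTheory.Nakayama
import Mathlib.RingTheory.TensorProduct.Basic
import Mathlib.RingTheory.LocalRing.MaximalIdeal.Basic
import Mathlib.LinearAlgebra.Span.Basic
import Mathlib.RingTheory.Finiteness.Defs
import HarnessLib

/-!
# Route `RamifiedHeegnerPair`, crux U₁ `LeafRankOneUpperAtThree` (stmt-BirchSwinnertonDyer-26022), line `partnerdescent` —
# partner kernel, algebra bricks (F6d) and the GORENSTEIN CORE of the (G3♭ˢ) derivation (Steps 1–3 of LEAD-G56-G3-NONSCALAR.md)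

HONEST FRAMING. Theorems only; helper file (`--supports stmt-BirchSwinnertonDyer-26022 --as helper`); pure commutative algebra over
Mathlib, no number theory, no named fact, no `sorry`; nothing booked; BSD is proved for no curve. Lead prover bsd-line-rhp-p2 g61, 2026-08-31.
Continues `…LeafPartnerOrdersDualLattice` ((F6a) (F6b) (F6c), lead g60).

WHY. The line's stub (G3♭ˢ) `Partnerdescent.stub_partnerCokernelThreeFreeFlatSplit` («`3 ∤ #coker(Φ_r(J^{qr}_0(M)) → Φ_r(A))` for the
class-minimal Jacquet–Langlands quotient `A` of a `3`-good partner `V`, `V[3]` irreducible, `V` split multiplicative at `q` with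
`ρ̄_{V,3}(Frob_q)` non-scalar») is DERIVATION-grade. The derivation (LEAD-G56-G3-NONSCALAR.md §2, pen second read AGREE) has three steps
whose ALGEBRA is typed and PROVED here in Mathlib generality, so that an assembly over typed arithmetic inputs is pure plumbing:

* Step 1 — «`B := X_q(J_0(qrM))_𝔪` is free of rank one over the local Hecke algebra `𝕋_B`, and `𝕋_B` is Gorenstein»: a cyclic
  faithful module is free of rank one (`bijective_toSpanSingleton_of_span_eq_top`), cyclicity from one generator modulo the maximal
  ideal is Nakayama (`span_singleton_eq_top_of_sup_maximalIdeal_smul_top`), and a PERFECT `𝕋_B`-INVARIANT `O`-bilinear pairing on a free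
  rank-one module yields a perfect trace `λ(t) = ⟨b, t b⟩` on `𝕋_B` (`bijective_dual_mulLeft_of_invariant_pairing`) — the hypothesis
  shape `hperf` of (F6b). Arithmetic inputs NOT here: multiplicity one `dim_k B/𝔪B ≤ 1` (Mazur ∕ Ribet 1990 ∕ Helm 2007 Lemma 6.5,
  from `ρ̄` non-scalar at `q`) and the perfectness of Grothendieck's monodromy pairing at a non-Eisenstein `𝔪` (SGA7 ∕ Ribet).
* Step 2 — «for Ribet's exact sequence `0 → X → B → A²` (`X = X_r(J^{qr}_0(M))_𝔪`), `X ≅ ω_{𝕋_B/J}` equivariantly, `J = Ann(X)`»: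
  with `B = 𝕋_B·b` the kernel is `I·b`, `I = {a : p(a b) = 0}` (`= Ann_{𝕋_B}(A²)` when `p` is onto:
  `smul_mem_ker_iff_mem_annihilator_top`), and as soon as `I = Ann(J)` ((F6c), landed) the Gorenstein trace transports `X` onto the
  functionals on `𝕋_B` vanishing on `J`, i.e. onto `ω_{𝕋_B/J} ⊂ ω_{𝕋_B}`, injectively, surjectively and `𝕋_B`-equivariantly
  (`exists_dualAnnihilator_transport`, over (F6b), landed). Arithmetic input NOT here: Ribet 1990 §4 ∕ Takahashi 2001 Prop. 3.1
  (the exact sequence of character groups, Eisenstein cokernel).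
* Step 3 — Papikian–Rabinoff's mechanism (Canad. J. Math. 68 (2016) = arXiv:1212.3574, §3 ¶23–25 and Lemma 32, held text read:
  `#coker = c = n/r`, `r ∣ n ∣ s`, and «a perfect `𝕋`-equivariant pairing `𝕋 × Λ → ℤ` forces `s = r`»): in element form over any
  base, for a finite free `O`-order `R` and `t ∈ K ⊗_O R`, «`t` stabilises `ω_R = Hom_O(R, O)`» ⟺ «`t ∈ R`»
  (`exists_tmul_eq_iff_forall_dual_mul_tmul`, over (F6a), landed); hence for `u ∈ K ⊗ R` the DENOMINATOR IDEALS of `u` in `R` and on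
  `ω_R` coincide (`denominators_eq_of_canonicalModule`), while the denominator ideal in any over-order is larger ((F6d):
  `denominator_subset_of_le`), and a sandwich of three denominator sets with equal ends is constant (`denominator_sandwich`). Arithmetic inputs NOT
  here: `n = δ_{qr,M}` (PR Lemma 24 ∕ Remark 31), `c = n/r = #coker` (PR (3.?) «coker.compgps»), `𝕋′ ⊂ End(J′)` (Jacquet–Langlands).

Nothing in this file is specific to `3`, to Hecke algebras or to Shimura curves; every statement is textbook commutative ∕ linear algebra
(dual bases, Nakayama, Gorenstein duality) and is cited as such; the memo is a tree document, not print.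
[cite: BourbakiAlgebraI1989, Ch. II §2 no. 6 (dual basis), Ch. II §5 no. 1 (extension of scalars)]
[cite: Matsumura1987, Thm. 2.2 (Nakayama), §18 Lemma 1 ∕ Thm. 18.1 (injective hull of the residue field, Gorenstein duality)]
[cite: PapikianRabinoff2016, §3 ¶23–¶25, Lemma 32 (arXiv:1212.3574 pp. 8–9)]
-/

set_option linter.dupNamespace false
set_option autoImplicit false

noncomputable section

open scoped TensorProduct

namespace Summit.BirchSwinnertonDyer.BirchSwinnertonDyer.Theorems.LeafPartnerOrders

/-! ## Step 1a — a cyclic faithful module is free of rank one; cyclicity by Nakayama -/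

section RankOne

variable {T : Type*} [CommRing T] {B : Type*} [AddCommGroup B] [Module T B]

/-- **Cyclic and faithful ⟹ free of rank one.** If `B = T·b` and no non-zero `t ∈ T` kills `b`, then `t ↦ t·b` is a bijection
`T → B` (so `B ≅ T` as `T`-modules, `1 ↦ b`). Step 1 of the (G3♭ˢ) derivation: `B = X_q(J_0(qrM))_𝔪` is cyclic by multiplicity one and
faithful over the Hecke algebra `𝕋_B` it defines. [cite: BourbakiAlgebraI1989, Ch. II §1 no. 11 (monogenous modules, annihilators)] -/
theorem bijective_toSpanSingleton_of_span_eq_top (b : B) (hspan : Submodule.span T {b} = ⊤)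
    (hfaith : ∀ t : T, t • b = 0 → t = 0) :
    Function.Bijective (LinearMap.toSpanSingleton T B b) := by
  constructor
  · intro t t' h
    have h' : (t - t') • b = 0 := by
      rw [sub_smul, sub_eq_zero]
      simpa [LinearMap.toSpanSingleton_apply] using h
    exact sub_eq_zero.mp (hfaith _ h')
  · intro x
    have hx : x ∈ Submodule.span T {b} := hspan ▸ Submodule.mem_top
    obtain ⟨t, ht⟩ := Submodule.mem_span_singleton.mp hx
    exact ⟨t, by simpa [LinearMap.toSpanSingleton_apply] using ht⟩

/-- **Nakayama form of cyclicity.** Over a LOCAL ring `T`, a finitely generated module `B` generated by `b` modulo `𝔪_T B` is generated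
by `b`. In the derivation: `dim_k B/𝔪B ≤ 1` with `B ≠ 0` (multiplicity one at a non-Eisenstein `𝔪`, `ρ̄` non-scalar at `q`) gives such
a `b`. [cite: Matsumura1987, Thm. 2.2 and Thm. 2.3 (Nakayama's lemma)] -/
theorem span_singleton_eq_top_of_sup_maximalIdeal_smul_top [IsLocalRing T] [Module.Finite T B] (b : B)
    (h : Submodule.span T {b} ⊔ IsLocalRing.maximalIdeal T • (⊤ : Submodule T B) = ⊤) :
    Submodule.span T {b} = ⊤ :=
  top_le_iff.mp (Submodule.le_of_le_smul_of_le_jacobson_bot Module.Finite.fg_top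
    (IsLocalRing.maximalIdeal_le_jacobson ⊥) h.symm.le)

end RankOne

/-! ## Step 1b — Gorenstein: a perfect invariant pairing on a free rank-one module is a perfect trace on the ring -/

section Gorenstein

variable {O : Type*} [CommRing O] {T : Type*} [CommRing T] [Algebra O T]
  {B : Type*} [AddCommGroup B] [Module O B] [Module T B] [IsScalarTower O T B]

/-- **Free of rank one + perfect invariant pairing ⟹ Gorenstein.** Let `B = T·b` be cyclic and faithful over the commutative
`O`-algebra `T` and let `β : B × B → O` be `O`-bilinear, PERFECT (`x ↦ β(x, ·)` is a bijection `B → B^∨`) and `T`-INVARIANT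
(`β(tx, y) = β(x, ty)`). Then `λ(t) := β(b, t·b)` is a perfect trace on `T`: `a ↦ λ(a·)` is a bijection `T → T^∨ = Hom_O(T, O)` — i.e.
`T ≅ ω_T`, `T` is Gorenstein; this is the hypothesis `hperf` of (F6b) `existsUnique_mem_annihilator_dual_mulLeft_eq`. In the derivation
`β` is Grothendieck's monodromy pairing on `X_q(J_0(qrM))_𝔪` (perfect at non-Eisenstein `𝔪`, Hecke operators self-adjoint).
[cite: Matsumura1987, §18 Thm. 18.1 (Gorenstein rings and duality)] [cite: BourbakiAlgebraI1989, Ch. II §2 no. 6] -/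
theorem bijective_dual_mulLeft_of_invariant_pairing (b : B) (hspan : Submodule.span T {b} = ⊤)
    (hfaith : ∀ t : T, t • b = 0 → t = 0) (β : B →ₗ[O] B →ₗ[O] O) (hperf : Function.Bijective β)
    (hinv : ∀ (t : T) (x y : B), β (t • x) y = β x (t • y)) :
    Function.Bijective fun a : T ↦
      (β b ∘ₗ (LinearMap.toSpanSingleton T B b).restrictScalars O) ∘ₗ LinearMap.mulLeft O a := by
  -- `e : T ≃ B`, `t ↦ t • b`, as an `O`-linear equivalence
  let e : T ≃ₗ[T] B := LinearEquiv.ofBijective _ (bijective_toSpanSingleton_of_span_eq_top b hspan hfaith)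
  let e' : T ≃ₗ[O] B := e.restrictScalars O
  have he' : ∀ t : T, e' t = t • b := fun t ↦ rfl
  -- the map of the statement is the composite of three bijections `a ↦ a • b ↦ β(a • b) ↦ β(a • b) ∘ e'`
  have hF : (fun a : T ↦ (β b ∘ₗ (LinearMap.toSpanSingleton T B b).restrictScalars O) ∘ₗ LinearMap.mulLeft O a)
      = e'.dualMap ∘ β ∘ (fun a : T ↦ a • b) := by
    funext a
    ext t
    simp only [LinearMap.coe_comp, Function.comp_apply, LinearMap.mulLeft_apply, LinearMap.coe_restrictScalars,
      LinearMap.toSpanSingleton_apply, LinearEquiv.dualMap_apply, he']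
    rw [mul_smul, ← hinv a b (t • b)]
  rw [hF]
  refine e'.dualMap.bijective.comp (hperf.comp ?_)
  exact (bijective_toSpanSingleton_of_span_eq_top b hspan hfaith)

end Gorenstein

/-! ## Step 2 — the kernel of `B = T·b → C` is carried by the Gorenstein trace onto `ω_{T/J} ⊂ ω_T`, equivariantly -/

section Transport

variable {O : Type*} [CommRing O] {T : Type*} [CommRing T] [Algebra O T]
  {B : Type*} [AddCommGroup B] [Module O B] [Module T B] [IsScalarTower O T B]
  {C : Type*} [AddCommGroup C] [Module T C]

/-- The ideal carrying the kernel of a map out of a cyclic module `B = T·b` ONTO `C` is the annihilator of `C`: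
`p(a·b) = 0 ⟺ a·C = 0`. In the derivation `C = X_q(J_0(qM))²_𝔪`, `I = Ann_{𝕋_B}(C) = ker(𝕋_B → 𝕋^{r-old})`.
[cite: BourbakiAlgebraI1989, Ch. II §1 no. 11 (annihilators)] -/
theorem smul_mem_ker_iff_mem_annihilator_top (b : B) (hspan : Submodule.span T {b} = ⊤) (p : B →ₗ[T] C)
    (hp : Function.Surjective p) (a : T) :
    p (a • b) = 0 ↔ a ∈ (⊤ : Submodule T C).annihilator := by
  rw [Submodule.mem_annihilator]
  constructor
  · intro h c _
    obtain ⟨y, rfl⟩ := hp c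
    obtain ⟨t, rfl⟩ := Submodule.mem_span_singleton.mp (hspan ▸ Submodule.mem_top : y ∈ Submodule.span T {b})
    rw [← map_smul, smul_smul, mul_comm, ← smul_smul, map_smul, h, smul_zero]
  · intro h
    rw [map_smul]
    exact h _ Submodule.mem_top

/-- **Step 2 (transport of the kernel onto `ω_{T/J}`).** Let `B = T·b` be cyclic and faithful over the commutative `O`-algebra `T`,
`p : B → C` `T`-linear with kernel `X`, `λ` a PERFECT trace on `T` (`a ↦ λ(a·)` bijective `T → T^∨`, Step 1b), and `J ⊆ T` an ideal
such that the ideal carrying `X` is `Ann_T(J)`: `p(a·b) = 0 ⟺ a ∈ Ann_T(J)` ((F6c) `annihilator_ker_eq_ker_of_mem_nonZeroDivisors`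
supplies this with `J = Ann_T(X)` from the new/old structure). Then `x = a·b ↦ λ(a·)` is an `O`-linear INJECTION `Φ : X → T^∨` whose image
is EXACTLY the functionals vanishing on `J` (`= (T/J)^∨ = ω_{T/J}`) and which is `T`-equivariant: `Φ(s·x) = Φ(x)(s·)`. So `X ≅ ω_{T/J}` as
`T/J`-modules — the conclusion of Step 2 and the hypothesis «perfect `𝕋′`-equivariant pairing `𝕋′ × Λ → O`» of Papikian–Rabinoff's
Lemma 32 with `𝕋′ = T/J`, `Λ = X`. [cite: Matsumura1987, §18 Lemma 1 and Thm. 18.1] [cite: PapikianRabinoff2016, Lemma 32 (arXiv:1212.3574 p. 9)] -/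
theorem exists_dualAnnihilator_transport (b : B) (hspan : Submodule.span T {b} = ⊤)
    (hfaith : ∀ t : T, t • b = 0 → t = 0) (p : B →ₗ[T] C) (lam : Module.Dual O T)
    (hperf : Function.Bijective fun a : T ↦ lam ∘ₗ LinearMap.mulLeft O a) (J : Ideal T)
    (hIJ : ∀ a : T, p (a • b) = 0 ↔ a ∈ J.annihilator) :
    ∃ Φ : LinearMap.ker p →ₗ[O] Module.Dual O T,
      Function.Injective Φ ∧
      (∀ x, Φ x ∈ (J.restrictScalars O).dualAnnihilator) ∧
      (∀ ψ ∈ (J.restrictScalars O).dualAnnihilator, ∃ x, Φ x = ψ) ∧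
      (∀ (s : T) (x : LinearMap.ker p), Φ (s • x) = Φ x ∘ₗ LinearMap.mulLeft O s) := by
  -- coordinates: `e : T ≃ B`, `κ = e⁻¹` restricted to the kernel
  let e : T ≃ₗ[T] B := LinearEquiv.ofBijective _ (bijective_toSpanSingleton_of_span_eq_top b hspan hfaith)
  have he : ∀ a : T, e a = a • b := fun a ↦ rfl
  have hsymm : ∀ a : T, e.symm (a • b) = a := fun a ↦ by rw [← he, LinearEquiv.symm_apply_apply]
  let κ : LinearMap.ker p →ₗ[O] T :=
    (e.symm.toLinearMap.restrictScalars O) ∘ₗ ((LinearMap.ker p).subtype.restrictScalars O)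
  have hκ : ∀ x : LinearMap.ker p, κ x = e.symm (x : B) := fun x ↦ rfl
  -- `Λ a = λ(a·)` as an `O`-linear map `T → T^∨`
  let Λ : T →ₗ[O] Module.Dual O T := (LinearMap.mul O T).compr₂ lam
  have hΛ : ∀ a : T, Λ a = lam ∘ₗ LinearMap.mulLeft O a := fun a ↦ by ext t; rfl
  refine ⟨Λ ∘ₗ κ, ?_, ?_, ?_, ?_⟩
  · -- injective: `Λ` is (hperf) and `κ` is (a restriction of an equivalence)
    intro x y hxy
    have h1 : Λ (κ x) = Λ (κ y) := hxy
    rw [hΛ, hΛ] at h1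
    have h2 : κ x = κ y := hperf.1 h1
    rw [hκ, hκ] at h2
    exact Subtype.ext (e.symm.injective h2)
  · -- image inside the functionals vanishing on `J`: `a = e⁻¹ x` carries `x ∈ ker p`, so `a ∈ Ann(J)`
    intro x
    rw [Submodule.mem_dualAnnihilator]
    intro j hj
    have ha : e.symm (x : B) ∈ J.annihilator := by
      rw [← hIJ, ← he, LinearEquiv.apply_symm_apply]
      exact x.2
    change Λ (κ x) j = 0
    rw [hΛ, hκ, LinearMap.comp_apply, LinearMap.mulLeft_apply, ← smul_eq_mul,
      (Submodule.mem_annihilator.mp ha) j hj, map_zero]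
  · -- onto the functionals vanishing on `J`: (F6b) gives `a ∈ Ann(J)` with `λ(a·) = ψ`; take `x = a • b`
    intro ψ hψ
    rw [Submodule.mem_dualAnnihilator] at hψ
    obtain ⟨a, ⟨haJ, haψ⟩, -⟩ :=
      existsUnique_mem_annihilator_dual_mulLeft_eq lam hperf J ψ (fun j hj ↦ hψ j hj)
    have hab : p (a • b) = 0 := (hIJ a).mpr haJ
    refine ⟨⟨a • b, hab⟩, ?_⟩
    change Λ (κ ⟨a • b, hab⟩) = ψ
    rw [hκ, hsymm, hΛ, haψ]
  · -- equivariance: `e⁻¹(s • x) = s * e⁻¹ x`, and `λ((s a)·t) = λ(a·(s t))`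
    intro s x
    change Λ (κ (s • x)) = Λ (κ x) ∘ₗ LinearMap.mulLeft O s
    rw [hκ, hκ, Submodule.coe_smul, map_smul, smul_eq_mul, hΛ, hΛ]
    ext t
    simp only [LinearMap.coe_comp, Function.comp_apply, LinearMap.mulLeft_apply]
    rw [mul_assoc, mul_left_comm]

end Transport

/-! ## Step 3 — Papikian–Rabinoff's mechanism: the stabiliser of `ω_R` in `R ⊗ K` is `R`; denominator ideals -/

section Stabilizer

variable {O : Type*} [CommRing O] {K : Type*} [CommRing K] [Algebra O K]
  {R : Type*} [CommRing R] [Algebra O R] [Module.Free O R] [Module.Finite O R]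

/-- **`Stab_{R_K}(ω_R) = R`** (element form). For a commutative `O`-algebra `R`, finite free as an `O`-module, and `t ∈ K ⊗_O R`
(`K` any commutative `O`-algebra, e.g. `Frac O`): `t` lies in (the image of) `R` iff for EVERY `O`-functional `φ` of `R` and every `x ∈ R`
the value `φ_K(t·(1 ⊗ x))` lies in (the image of) `O` — i.e. iff `t` carries the lattice `ω_R = Hom_O(R, O)` of `ω_R ⊗ K = Hom_K(R_K, K)`
(`t·Ψ := Ψ(t ·)`) into itself. «⇐» is (F6a) at `x = 1`; «⇒» is `φ_K(1 ⊗ y x) = φ(yx)`. Step 3 of the (G3♭ˢ) derivation reads it for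
`R = 𝕋′_𝔪`: an element of `𝕋′ ⊗ ℚ` preserving `X ≅ ω_{𝕋′}` lies in `𝕋′_𝔪`. [cite: BourbakiAlgebraI1989, Ch. II §2 no. 6 and §5 no. 1]
[cite: PapikianRabinoff2016, Lemma 32 (proof) (arXiv:1212.3574 p. 9)] -/
theorem exists_tmul_eq_iff_forall_dual_mul_tmul (t : K ⊗[O] R) :
    (∃ y : R, (1 : K) ⊗ₜ[O] y = t) ↔
      ∀ (φ : Module.Dual O R) (x : R),
        (TensorProduct.AlgebraTensorModule.rid O K K) (φ.baseChange K (t * (1 : K) ⊗ₜ[O] x)) ∈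
          Set.range (algebraMap O K) := by
  constructor
  · rintro ⟨y, rfl⟩ φ x
    refine ⟨φ (y * x), ?_⟩
    rw [Algebra.TensorProduct.tmul_mul_tmul, one_mul, LinearMap.baseChange_tmul,
      TensorProduct.AlgebraTensorModule.rid_tmul, Algebra.algebraMap_eq_smul_one]
  · intro h
    apply exists_tmul_eq_of_forall_dual_baseChange
    intro φ
    have := h φ 1
    rwa [← Algebra.TensorProduct.one_def, mul_one] at this

/-- **Denominator ideals coincide on `R` and on `ω_R`** (Papikian–Rabinoff's `s = r`, `ℓ`-adic-ready form). For `u ∈ K ⊗_O R` and a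
scalar `a ∈ O`: `a·u ∈ R` iff `a·u` stabilises `ω_R`. With `R = 𝕋′_𝔪`, `u = e_f`, `O = ℤ₃`: the `3`-adic denominator of the
idempotent `e_f` in the Hecke algebra equals its `3`-adic denominator as an endomorphism of the lattice `X ≅ ω_{𝕋′_𝔪}` — whence, with
`r ∣ n ∣ s` (PR §3 ¶23, Lemma 32) and `c = n/r` (PR (3.6)), `3 ∤ c`. [cite: PapikianRabinoff2016, §3 ¶23–¶25 and Lemma 32 (arXiv:1212.3574 pp. 8–9)] -/
theorem denominators_eq_of_canonicalModule (u : K ⊗[O] R) :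
    {a : O | ∃ y : R, (1 : K) ⊗ₜ[O] y = a • u} =
      {a : O | ∀ (φ : Module.Dual O R) (x : R),
        (TensorProduct.AlgebraTensorModule.rid O K K) (φ.baseChange K ((a • u) * (1 : K) ⊗ₜ[O] x)) ∈
          Set.range (algebraMap O K)} := by
  ext a
  exact exists_tmul_eq_iff_forall_dual_mul_tmul (a • u)

omit [Module.Free O R] [Module.Finite O R] in
/-- **(F6d) denominators shrink in over-orders.** If an `O`-subalgebra `S ⊆ K ⊗_O R` contains (the image of) `R` — an over-order, e.g.
the endomorphisms of `J′` containing the Hecke algebra `𝕋′` — then every `R`-denominator of `u` is an `S`-denominator of `u`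
(`{a : a·u ∈ R} ⊆ {a : a·u ∈ S}`: «`n ∣ s`» in PR Lemma 32). [cite: PapikianRabinoff2016, §3 ¶23 and Lemma 32 (proof, «n divides s»)] -/
theorem denominator_subset_of_le (S : Subalgebra O (K ⊗[O] R))
    (hS : ∀ y : R, (1 : K) ⊗ₜ[O] y ∈ S) (u : K ⊗[O] R) :
    {a : O | ∃ y : R, (1 : K) ⊗ₜ[O] y = a • u} ⊆ {a : O | a • u ∈ S} := by
  rintro a ⟨y, hy⟩
  show a • u ∈ S
  rw [← hy]
  exact hS y

omit [Module.Free O R] [Module.Finite O R] in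
/-- **The sandwich.** Three nested denominator sets with equal ends are equal: with `D_R(u) ⊆ D_{End}(u) ⊆ D_Λ(u)` («`r ∣ n ∣ s`») and
`D_R(u) = D_Λ(u)` (`denominators_eq_of_canonicalModule` for `Λ ≅ ω_R`), the middle one equals both («`n = r`», `c = 1` — or, run
`ℓ`-adically, `ℓ ∤ c`). Pure order theory, recorded for the assembly. [cite: PapikianRabinoff2016, Lemma 32 (arXiv:1212.3574 p. 9)] -/
theorem denominator_sandwich {α : Type*} {D₁ D₂ D₃ : Set α} (h₁₂ : D₁ ⊆ D₂) (h₂₃ : D₂ ⊆ D₃) (h₁₃ : D₁ = D₃) :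
    D₂ = D₁ ∧ D₂ = D₃ :=
  ⟨Set.Subset.antisymm (h₁₃ ▸ h₂₃) h₁₂, Set.Subset.antisymm h₂₃ (h₁₃ ▸ h₁₂)⟩

end Stabilizer

end Summit.BirchSwinnertonDyer.BirchSwinnertonDyer.Theorems.LeafPartnerOrders

end
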